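import Literature.NumberTheory.ComplexMultiplication.MainTheoremCMLevelStructureCore
import Literature.NumberTheory.ComplexMultiplication.MainTheoremCMLevelStructureCorePrime
import Literature.NumberTheory.ComplexMultiplication.MainTheoremCMLevelField
import HarnessLib

/-!
# The main theorem of complex multiplication — S7a, the level structure from the named facts (Shimura 1998, §18.6, pp. 125–129)

Topic `Literature/NumberTheory/ComplexMultiplication`, namespace `Literature.NumberTheory.ComplexMultiplication`.
THEOREMS ONLY (no definition, no named fact; net Literature debt **0**).  Cell `hodgecm-mathlib` (D-0151), fan B-II, line
`b2-main-theorem-cm` (crux `stmt-HodgeConjecture-24834`), registered stub **S7a `stub_composition : StubComposition`** of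
`Cruxes/H21/Lines/b2_main_theorem_cm.lean` (v2m):
`shimura1998_prop26_definedOverNumberField → FactRH' → FactS5c → shimuraTaniyamaPair → S5 → S8 → S9 → levelStructure`.
This file proves **`levelStructure_of_facts`**: from the named facts of the line AS HYPOTHESES — (F-II2)
`shimura1998_prop26_definedOverNumberField` (W(ii), §12.4 Prop. 26: models of every ideal class over a number field), (F-S2)
`shimuraTaniyamaPair` (§13.1 Thm. 1 (i)), the produced-data reduction binder `FactRH′` (cofinite Néron data of a finite
family with reduction of homomorphisms; [BombieriGubler2006] 10.3.9, §11.1 Prop. 12) and (F-S5c)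
`exists_isTateCompatible_family_conjFrob` (§11.1 Prop. 14 (i), §18.6 p. 127) — the junction's `levelStructure`
(`MainTheoremCMLevelUniformization.lean`): a level-independent `ν` (here `ν = N((s_𝐡))`) and, for every level `N > 0` with
`ℓ ∣ N`, a level-`N` uniformisation `ξ′_N` of `((A₀ ⊗ ℂ)^σ, (ι₀ ⊗ ℂ)^σ)` with (2)_N and the relative polarisation clause.
The stub closes by `fun hII2 hRH hS5c hS2 _ _ _ => levelStructure_of_facts hII2 hS2 hRH hS5c` (S5/S8/S9 are tree theorems
and are not consumed).  Proof: the LEVEL FIELD (`exists_levelField`, B-p09: W(ii) class-representative models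
`exists_intermediateField_classRepresentativeModels`, the `N`-torsion field `exists_intermediateField_forall_torsionPoints_baseChange_complex`,
the common field of definition of the homomorphisms `exists_intermediateField_isGalois_forall_surjective_homBaseChange` and the
ray class field `C_N` — Shimura p. 127 (iii)–(iv)) followed by the per-level CORE `exists_isLevelUniformization_of_levelField`
(`MainTheoremCMLevelStructureCore.lean`).  HC_CM is proved only modulo the 7 printed citations until rung 0 closes; nothing
here changes that.

## References

* [Shimura1998] G. Shimura, *Abelian Varieties with Complex Multiplication and Modular Functions*, Princeton Univ. Press
  1998: §18.6, proof of Thm. 18.6, pp. 125–129 (held chunks p0164–p0169; the passage used, pp. 127–128, is p0166–p0168); §13.1 Thm. 1 (i)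
  (p. 97); §12.4 Prop. 26 (p. 96); §11.1 Prop. 12 (p. 83), Prop. 14 (i) (p. 85).
* [BombieriGubler2006] E. Bombieri, W. Gubler, *Heights in Diophantine Geometry*, Cambridge 2006, 10.3.9 (Néron model).
-/

set_option autoImplicit false

noncomputable section

open CategoryTheory CategoryTheory.Limits AlgebraicGeometry NumberField IsDedekindDomain
open scoped NumberField nonZeroDivisors
open Literature.AlgebraicGeometry.Motives Literature.AlgebraicGeometry.Motives.AbelianVariety
open Literature.AlgebraicGeometry.Motives.AbelianVariety.GoodReductionAt
open Literature.AlgebraicGeometry.ComplexMultiplication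
open Literature.NumberTheory.NumberFields
open Literature.NumberTheory.GaloisRepresentations (ideleGroup)
open Literature.NumberTheory.Automorphic.FiniteAdeleRing (toFractionalIdeal)

namespace Literature.NumberTheory.ComplexMultiplication

/-- **S7a — the level-`N` structure from the named facts** (Shimura 1998, §18.6, proof of Thm. 18.6, pp. 125–129, up to (∗∗∗)
and «`X^σ` corresponds to `(g(d)g(d)^ρ)⁻¹pζ` with respect to `ξ′`», in the divisor-free Weil-pairing currency of the junction
`IsLevelUniformization`): for a number-field model `(A₀, ι₀)` of type `(K, Φ)`, a divisor `X`, a uniformisation `ξ` of `A₀ ⊗ ℂ` of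
type `(K, Φ, 𝔞)`, `σ ∈ Aut(ℂ/K*)` with `σ = [s, K*]` and a prime `ℓ`, there is a level-independent `ν = N((s_𝐡))` such that every
level `N > 0` with `ℓ ∣ N` carries `ξ′_N, q, β` with `IsLevelUniformization … N ξ′_N q β ν` — GIVEN the named facts (F-II2), (F-S2),
`FactRH′`, (F-S5c) as hypotheses (binder texts of the b2 workfile).  Proof: `exists_levelField` (the field `k'` of p. 127
(iii)–(iv) with the class-representative models of p. 126 and `C_N`) then `exists_isLevelUniformization_of_levelField`
(pp. 127–129). [cite: Shimura1998, §18.6 proof of Thm. 18.6, pp. 125–129 (esp. pp. 127–128); §13.1 Thm. 1 (i) (p. 97); §12.4 Prop. 26 (p. 96); §11.1 Prop. 12 (p. 83) and Prop. 14 (i) (p. 85)]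
[cite: BombieriGubler2006, 10.3.9 (p. 334)] -/
theorem levelStructure_of_facts
    (hII2 : shimura1998_prop26_definedOverNumberField)
    (hS2 : shimuraTaniyamaPair)
    (hRH : ∀ {k : Type} [Field k] [NumberField k] {ι : Type} [Finite ι] (A : ι → AbelianVariety k),
      ∃ S : Set (HeightOneSpectrum (𝓞 k)), S.Finite ∧ ∀ v ∉ S, ∃ R : ∀ i, (A i).GoodReductionAt v,
        (∀ i j, Nonempty (GoodReductionAt.HomReduction (R i) (R j))) ∧
        ∀ {F₀ : Type} [Field F₀] [NumberField F₀] [Algebra F₀ k] (a : ι) (γ : k ≃ₐ[F₀] k)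
          (hγ : IsArithFrobAt (𝓞 F₀) γ v.asIdeal) (p n : ℕ) [ExpChar v.asIdeal.ResidueField p]
          (hq : Nat.card (𝓞 F₀ ⧸ v.asIdeal.under (𝓞 F₀)) = p ^ n),
          (∀ i, Nonempty (GoodReductionAt.HomReduction (R i) ((R a).conjFrob γ hγ p n hq))) ∧
          (∀ i, Nonempty (GoodReductionAt.HomReduction ((R a).conjFrob γ hγ p n hq) (R i))))
    (hS5c : ∀ {F₀ k : Type} [Field F₀] [NumberField F₀] [Field k] [NumberField k] [Algebra F₀ k]
      {v : HeightOneSpectrum (𝓞 k)} {ι : Type} {A : ι → AbelianVariety k}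
      (R : ∀ i, (A i).GoodReductionAt v) (H : ∀ i j, GoodReductionAt.HomReduction (R i) (R j)) (a : ι)
      (γ : k ≃ₐ[F₀] k) (hγ : IsArithFrobAt (𝓞 F₀) γ v.asIdeal) (p n : ℕ) [ExpChar v.asIdeal.ResidueField p]
      (hq : Nat.card (𝓞 F₀ ⧸ v.asIdeal.under (𝓞 F₀)) = p ^ n)
      (Hγ : ∀ i, GoodReductionAt.HomReduction (R i) ((R a).conjFrob γ hγ p n hq))
      (Hγ' : ∀ i, GoodReductionAt.HomReduction ((R a).conjFrob γ hγ p n hq) (R i)) (ℓ : ℕ) [Fact ℓ.Prime],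
      GoodReductionAt.HomReduction.exists_isTateCompatible_family_conjFrob R H a γ hγ p n hq Hγ Hγ' ℓ) :
    levelStructure := by
  intro K _ _ _ Φ _ 𝔞 𝔟 L _ _ _ A₀ ι₀ hA₀ X πA hπA _ ξ σ s hs h𝔟 πσ hπσ _ ℓ _ hdomA hdomσ
  -- ν := N((s_𝐡)) ∈ ℚ ⊂ K, level-independent
  refine ⟨((FractionalIdeal.absNorm (toFractionalIdeal (𝓞 (traceField Φ)) (traceField Φ)
      (IdeleAction.finitePart (traceField Φ) s)) : ℚ) : K), ?_⟩
  intro N hN hℓN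
  -- the level field `k'` (Shimura p. 127 (iii)–(iv)) with the class representatives (p. 126) and `C_N`
  obtain ⟨M, hfd, hNF, instA, instT, instG, γ, hσγ, j, Arep, ιrep, 𝔞rep, h𝔞rep, hArep, ηrep, htors, hrat, hrat',
    hratγ, hratγ'⟩ := exists_levelField' hII2 Φ A₀ ι₀ hA₀ σ N hN
  haveI := hNF; letI := instA; haveI := instT; haveI := instG
  exact exists_isLevelUniformization_of_levelField Φ 𝔞 𝔟 A₀ ι₀ hA₀ X πA hπA ξ σ s hs h𝔟 πσ hπσ ℓ N hN hℓN γ hσγ j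
    Arep ιrep 𝔞rep h𝔞rep ηrep htors hrat hrat' hratγ hratγ' hS2 hRH hS5c

/-- **S7a from the DEGREE-ONE Shimura–Taniyama fact (edition E1)** — the same level-`N` structure
(`levelStructure`) from (F-II2), the ABSOLUTE-DEGREE-ONE pair fact `shimuraTaniyamaPair_degOne` ([Shimura1998] §13.1
Thm. 1 (i) read at `N𝔭 = p`, B-typ02 `ShimuraTaniyamaPairDegOne.lean`), `FactRH′` and (F-S5c): the core only ever consumes
the pair fact at Chebotarev primes of absolute degree one (`exists_frobeniusPrime`, `p 1 hcard`), through
`exists_hom_iso_redHom_comp_eq_relFrobenius_of_pair_degOne` (`MainTheoremCMLevelKappaOfPairDegOne`) inside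
`exists_isLevelUniformization_of_levelField_degOne`.  Proof = `levelStructure_of_facts` verbatim with that core
(B-plan1 EDITIONS-h21-fanB §E1, director g3 BATCH 73/74/79 (ii)); b2-main's v2q reads `shimura1998_thm18_6` through it.
[cite: Shimura1998, §18.6 proof of Thm. 18.6, pp. 125–129 (esp. pp. 127–128); §13.1 Thm. 1 (i) (p. 97)] -/
theorem levelStructure_of_facts_degOne
    (hII2 : shimura1998_prop26_definedOverNumberField)
    (hS2 : shimuraTaniyamaPair_degOne)
    (hRH : ∀ {k : Type} [Field k] [NumberField k] {ι : Type} [Finite ι] (A : ι → AbelianVariety k),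
      ∃ S : Set (HeightOneSpectrum (𝓞 k)), S.Finite ∧ ∀ v ∉ S, ∃ R : ∀ i, (A i).GoodReductionAt v,
        (∀ i j, Nonempty (GoodReductionAt.HomReduction (R i) (R j))) ∧
        ∀ {F₀ : Type} [Field F₀] [NumberField F₀] [Algebra F₀ k] (a : ι) (γ : k ≃ₐ[F₀] k)
          (hγ : IsArithFrobAt (𝓞 F₀) γ v.asIdeal) (p n : ℕ) [ExpChar v.asIdeal.ResidueField p]
          (hq : Nat.card (𝓞 F₀ ⧸ v.asIdeal.under (𝓞 F₀)) = p ^ n),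
          (∀ i, Nonempty (GoodReductionAt.HomReduction (R i) ((R a).conjFrob γ hγ p n hq))) ∧
          (∀ i, Nonempty (GoodReductionAt.HomReduction ((R a).conjFrob γ hγ p n hq) (R i))))
    (hS5c : ∀ {F₀ k : Type} [Field F₀] [NumberField F₀] [Field k] [NumberField k] [Algebra F₀ k]
      {v : HeightOneSpectrum (𝓞 k)} {ι : Type} {A : ι → AbelianVariety k}
      (R : ∀ i, (A i).GoodReductionAt v) (H : ∀ i j, GoodReductionAt.HomReduction (R i) (R j)) (a : ι)
      (γ : k ≃ₐ[F₀] k) (hγ : IsArithFrobAt (𝓞 F₀) γ v.asIdeal) (p n : ℕ) [ExpChar v.asIdeal.ResidueField p]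
      (hq : Nat.card (𝓞 F₀ ⧸ v.asIdeal.under (𝓞 F₀)) = p ^ n)
      (Hγ : ∀ i, GoodReductionAt.HomReduction (R i) ((R a).conjFrob γ hγ p n hq))
      (Hγ' : ∀ i, GoodReductionAt.HomReduction ((R a).conjFrob γ hγ p n hq) (R i)) (ℓ : ℕ) [Fact ℓ.Prime],
      GoodReductionAt.HomReduction.exists_isTateCompatible_family_conjFrob R H a γ hγ p n hq Hγ Hγ' ℓ) :
    levelStructure := by
  intro K _ _ _ Φ _ 𝔞 𝔟 L _ _ _ A₀ ι₀ hA₀ X πA hπA _ ξ σ s hs h𝔟 πσ hπσ _ ℓ _ hdomA hdomσ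
  -- ν := N((s_𝐡)) ∈ ℚ ⊂ K, level-independent
  refine ⟨((FractionalIdeal.absNorm (toFractionalIdeal (𝓞 (traceField Φ)) (traceField Φ)
      (IdeleAction.finitePart (traceField Φ) s)) : ℚ) : K), ?_⟩
  intro N hN hℓN
  -- the level field `k'` (Shimura p. 127 (iii)–(iv)) with the class representatives (p. 126) and `C_N`
  obtain ⟨M, hfd, hNF, instA, instT, instG, γ, hσγ, j, Arep, ιrep, 𝔞rep, h𝔞rep, hArep, ηrep, htors, hrat, hrat',
    hratγ, hratγ'⟩ := exists_levelField' hII2 Φ A₀ ι₀ hA₀ σ N hN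
  haveI := hNF; letI := instA; haveI := instT; haveI := instG
  exact exists_isLevelUniformization_of_levelField_degOne Φ 𝔞 𝔟 A₀ ι₀ hA₀ X πA hπA ξ σ s hs h𝔟 πσ hπσ ℓ N hN hℓN γ
    hσγ j Arep ιrep 𝔞rep h𝔞rep ηrep htors hrat hrat' hratγ hratγ' hS2 hRH hS5c

/-- **S7a from row II-2, the DEGREE-ONE Shimura–Taniyama fact and the MERGED produced reduction fact (S5c′)** (edition E4,
director g3 BATCH 90, B-plan1 `EDITIONS-h21-fanB.md` §E4): the two reduction-theoretic binders `hRH` (cofinite Néron data with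
reduction of homomorphisms, incl. to/from the Frobenius conjugate) and `hS5c` (Tate-compatible ℓ-adic specialisations, §11.1
Prop. 14 (i)) of `levelStructure_of_facts_degOne` are replaced by the ONE named produced fact
`AbelianVariety.exists_finite_forall_exists_goodReductionAt_homReduction_conjFrob_isTateCompatible` (typed p618079), the shape the
core `exists_isLevelUniformization_of_levelField_degOne'` (`MainTheoremCMLevelStructureCorePrime`) consumes.  Proof = the landed
closer verbatim (level field by `exists_levelField'`, then the E4 core); b2-main's v2s reads `shimura1998_thm18_6` through it.
[cite: Shimura1998, §18.6 proof of Thm. 18.6, pp. 125–129 (esp. pp. 127–128); §13.1 Thm. 1 (i) (p. 97); §11.1 Prop. 12 (p. 83) and Prop. 14 (i) (p. 85)] -/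
theorem levelStructure_of_facts_degOne'
    (hII2 : shimura1998_prop26_definedOverNumberField)
    (hS2 : shimuraTaniyamaPair_degOne)
    (hRHS5c : AbelianVariety.exists_finite_forall_exists_goodReductionAt_homReduction_conjFrob_isTateCompatible) :
    levelStructure := by
  intro K _ _ _ Φ _ 𝔞 𝔟 L _ _ _ A₀ ι₀ hA₀ X πA hπA _ ξ σ s hs h𝔟 πσ hπσ _ ℓ _ hdomA hdomσ
  -- ν := N((s_𝐡)) ∈ ℚ ⊂ K, level-independent
  refine ⟨((FractionalIdeal.absNorm (toFractionalIdeal (𝓞 (traceField Φ)) (traceField Φ)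
      (IdeleAction.finitePart (traceField Φ) s)) : ℚ) : K), ?_⟩
  intro N hN hℓN
  -- the level field `k'` (Shimura p. 127 (iii)–(iv)) with the class representatives (p. 126) and `C_N`
  obtain ⟨M, hfd, hNF, instA, instT, instG, γ, hσγ, j, Arep, ιrep, 𝔞rep, h𝔞rep, hArep, ηrep, htors, hrat, hrat',
    hratγ, hratγ'⟩ := exists_levelField' hII2 Φ A₀ ι₀ hA₀ σ N hN
  haveI := hNF; letI := instA; haveI := instT; haveI := instG
  exact exists_isLevelUniformization_of_levelField_degOne' Φ 𝔞 𝔟 A₀ ι₀ hA₀ X πA hπA ξ σ s hs h𝔟 πσ hπσ ℓ N hN hℓN γ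
    hσγ j Arep ιrep 𝔞rep h𝔞rep ηrep htors hrat hrat' hratγ hratγ' hS2 hRHS5c

/-- **S7a from row II-2, the UNRAMIFIED degree-one Shimura–Taniyama fact (S2₁′) and the merged produced reduction fact (S5c′)**
(edition E1′ on top of E4, director g3 BATCH 103; A-p02's E2 road memo): as `levelStructure_of_facts_degOne'` with the pair fact
weakened to `shimuraTaniyamaPair_degOne'` (`N𝔭 = p` and `p ∤ d(K)`), which the core `exists_isLevelUniformization_of_levelField_degOne''`
consumes by choosing the Frobenius prime prime to `N · |d(K)|`.  Proof = the landed closer verbatim (level field by `exists_levelField'`,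
then the E1′ core); b2-main's next edition and the floor's strength swap read `shimura1998_thm18_6` / `levelStructure` through it.
[cite: Shimura1998, §18.6 proof of Thm. 18.6, pp. 125–129 (esp. pp. 127–128); §13.1 Thm. 1 (i) (p. 97); §13.2 (pp. 99–100); §11.1 Prop. 12 (p. 83) and Prop. 14 (i) (p. 85)] -/
theorem levelStructure_of_facts_degOne''
    (hII2 : shimura1998_prop26_definedOverNumberField)
    (hS2 : shimuraTaniyamaPair_degOne')
    (hRHS5c : AbelianVariety.exists_finite_forall_exists_goodReductionAt_homReduction_conjFrob_isTateCompatible) :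
    levelStructure := by
  intro K _ _ _ Φ _ 𝔞 𝔟 L _ _ _ A₀ ι₀ hA₀ X πA hπA _ ξ σ s hs h𝔟 πσ hπσ _ ℓ _ hdomA hdomσ
  -- ν := N((s_𝐡)) ∈ ℚ ⊂ K, level-independent
  refine ⟨((FractionalIdeal.absNorm (toFractionalIdeal (𝓞 (traceField Φ)) (traceField Φ)
      (IdeleAction.finitePart (traceField Φ) s)) : ℚ) : K), ?_⟩
  intro N hN hℓN
  -- the level field `k'` (Shimura p. 127 (iii)–(iv)) with the class representatives (p. 126) and `C_N`
  obtain ⟨M, hfd, hNF, instA, instT, instG, γ, hσγ, j, Arep, ιrep, 𝔞rep, h𝔞rep, hArep, ηrep, htors, hrat, hrat',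
    hratγ, hratγ'⟩ := exists_levelField' hII2 Φ A₀ ι₀ hA₀ σ N hN
  haveI := hNF; letI := instA; haveI := instT; haveI := instG
  exact exists_isLevelUniformization_of_levelField_degOne'' Φ 𝔞 𝔟 A₀ ι₀ hA₀ X πA hπA ξ σ s hs h𝔟 πσ hπσ ℓ N hN hℓN γ
    hσγ j Arep ιrep 𝔞rep h𝔞rep ηrep htors hrat hrat' hratγ hratγ' hS2 hRHS5c

end Literature.NumberTheory.ComplexMultiplication

end
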